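import Literature.AlgebraicGeometry.Resolution.MacaulayficationKawasakiCorollaries
import HarnessLib

/-!
# Kawasaki's input (KI-a), (KI-b), (KI-c) in Česnavičius's form

Topic: `Literature/AlgebraicGeometry/Resolution`. Brick of the proof of the named facts
`KawasakiMacaulayfication` / `CesnaviciusMacaulayfication`. Česnavičius 2021, Prop. 3.10
("(Kaw-input)") packages three consequences of Kawasaki 2000, §§2–3 for a CM-secant sequence
`r₁,…,r_σ` (in Kawasaki's numbering `r_t = x_{d+1-t}`, `(r₁,…,r_t) = q_{d+1-t}`, a `p`-standard system of
parameters of type `d - 1` read backwards, [Cesnavicius2021, Rem. 3.9]):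

* (KI-b) `r_s,…,r₁` is a `d`-sequence on `M' = M/(r')M` for every secant-for-`M/(r₁,…,r_s)M`
  sequence `r'` — Kawasaki Cor. 2.10;
* (KI-c) for `m, n > 0` the `r_s^m`-torsion and the `(r₁,…,r_s)`-torsion of `M'/I_{s-1}ⁿM'` agree,
  `I_j = ∏_{i ≤ j} (r₁,…,rᵢ)` — Kawasaki Cor. 3.2;
* (KI-a) if `r'_{s'}` is `M'/(r₁,…,r_s)M'`-regular (`M' = M/(r'₁,…,r'_{s'-1})M`) then it is
  `M'`-regular and `M'/I_sⁿM'`-regular — Kawasaki Cor. 3.3.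

Here they are derived, for the abstract `p`-standard systems `IsPStandard M xs` of this
development (Kawasaki's Lemma 2.5 built into the definition), from the files
`MacaulayficationPStandardDSequence` and `MacaulayficationKawasakiCorollaries`, in the colon-module
language (`colonBy`, `colonByIdeal`) and, for (KI-a), also in terms of `IsSMulRegular` on the
quotient module. `0`-based indexing as in `MacaulayficationKawasakiInduction.lean`:
`tailIdeal xs i = (xs[i],…,xs[d-1])`, `prodPow xs n i j = ∏_{t ∈ [i,j]} (tailIdeal xs t)^{n t}`; the
ideal `I_s` of Česnavičius is `prodPow xs 1 (d - s) (d - 1)` and `I_sⁿ = prodPow xs n (d - s) (d - 1)`.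

Everything is proved; no named fact is introduced.

## References

* [Cesnavicius2021] K. Česnavičius, *Macaulayfication of Noetherian schemes*, Duke Math. J. 170
  (2021), Prop. 3.10 (Kaw-input), Rem. 3.9, Rem. 3.11.
* [Kawasaki2000] T. Kawasaki, *On Macaulayfication of Noetherian schemes*, Trans. AMS 352 (2000),
  Cor. 2.10, Cor. 3.2, Cor. 3.3.
-/

namespace Literature.AlgebraicGeometry.Resolution

open Ideal Submodule Module IsLocalRing
open scoped Pointwise

universe u v

section Module

variable {R : Type u} [CommRing R] {M : Type v} [AddCommGroup M] [Module R M]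

/-- **`a` is `M/P`-regular iff `P :_M a = P`.** [folklore] -/
theorem isSMulRegular_quotient_iff_colonBy_eq (P : Submodule R M) (a : R) :
    IsSMulRegular (M ⧸ P) a ↔ colonBy P a = P := by
  constructor
  · intro h
    refine le_antisymm (fun m hm => ?_) (le_colonBy P a)
    have h0 : a • P.mkQ m = a • 0 := by
      rw [smul_zero, ← map_smul, Submodule.mkQ_apply, Submodule.Quotient.mk_eq_zero]
      exact hm
    have := h h0
    rwa [Submodule.mkQ_apply, Submodule.Quotient.mk_eq_zero] at this
  · intro h x y hxy
    induction x using Submodule.Quotient.induction_on with | _ x =>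
    induction y using Submodule.Quotient.induction_on with | _ y =>
    rw [Submodule.Quotient.eq]
    have hxy' : a • (x - y) ∈ P := by
      rw [smul_sub, ← Submodule.Quotient.eq, Submodule.Quotient.mk_smul, Submodule.Quotient.mk_smul]
      exact hxy
    have : x - y ∈ colonBy P a := hxy'
    rwa [h] at this

/-- `∏ q_t^n = (∏ q_t)ⁿ` for a constant exponent. [folklore] -/
theorem prodPow_const (xs : List R) (n i j : ℕ) :
    prodPow xs (fun _ => n) i j = prodPow xs (fun _ => 1) i j ^ n := by
  rw [prodPow, prodPow, ← Finset.prod_pow]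
  exact Finset.prod_congr rfl fun t _ => by rw [pow_one]

end Module

variable {R : Type u} [CommRing R] [IsLocalRing R] [IsNoetherianRing R]
variable {M : Type v} [AddCommGroup M] [Module R M] [Module.Finite R M]

namespace IsPStandard

variable {xs : List R}

/-- **(KI-b)** [Cesnavicius2021, Prop. 3.10 (b)] = [Kawasaki2000, Cor. 2.10]: for a `p`-standard
`xs` and any subsystem of parameters `ys ⊆ 𝔪` of `M/(xs.drop k)M`, the tail `xs.drop k` is a
`d`-sequence on `M/(ys)M` (in Kawasaki's sense `IsKDSequence`, equivalently the tree's
`IsDSequence` on the quotient module). [cite: Cesnavicius2021, Prop. 3.10 (b)] -/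
theorem kawasakiInput_b (hx : IsPStandard M xs) (k : ℕ) {ys : List R}
    (hys : IsSecantSequence M (xs.drop k ++ ys)) (hym : ∀ y ∈ ys, y ∈ maximalIdeal R) :
    IsKDSequence (ofList ys • ⊤ : Submodule R M) (xs.drop k) :=
  hx.isKDSequence (X₀ := xs.take k) (D := xs.drop k) (List.take_append_drop k xs).symm hys hym

/-- **(KI-c)** [Cesnavicius2021, Prop. 3.10 (c)] = [Kawasaki2000, Cor. 3.2] (`0`-based, `p + 1 < d`,
so that the product `I = q_{p+2}⋯q_d` is over a nonempty range): for a subsystem of parameters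
`ys ⊆ 𝔪` of `M/q_{p+1}M` and `m, n > 0`, the `xs[p]^m`-torsion and the `q_{p+1}`-torsion of
`M/((ys)M + IⁿM)` agree: `[(ys)M + IⁿM] :_M xs[p]^m = [(ys)M + IⁿM] :_M q_{p+1}`.
[cite: Cesnavicius2021, Prop. 3.10 (c)] -/
theorem kawasakiInput_c (hx : IsPStandard M xs) {p : ℕ} (hp : p + 1 < xs.length) {m n : ℕ}
    (hm : 0 < m) (hn : 0 < n) {ys : List R} (hys : IsSecantSequence M (xs.drop p ++ ys))
    (hym : ∀ y ∈ ys, y ∈ maximalIdeal R) :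
    colonBy (ofList ys • ⊤ ⊔ prodPow xs (fun _ => n) (p + 1) (xs.length - 1) • ⊤ : Submodule R M)
        (xs[p] ^ m) =
      colonByIdeal (ofList ys • ⊤ ⊔ prodPow xs (fun _ => n) (p + 1) (xs.length - 1) • ⊤ :
        Submodule R M) (tailIdeal xs p) :=
  hx.kawasaki32 (by omega) (by omega) (fun _ _ => hn) hm hys hym

/-- **(KI-a)** [Cesnavicius2021, Prop. 3.10 (a)] = [Kawasaki2000, Cor. 3.3], colon form (`0`-based,
`k < d`): let `Y, y_u ⊆ 𝔪` be a subsystem of parameters of `M/q_{k+1}M` such that `y_u` is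
`M/((Y)M + q_{k+1}M)`-regular, i.e. `[(Y)M + q_{k+1}M] : y_u = (Y)M + q_{k+1}M`. Then `y_u` is
`M/(Y)M`-regular and `M/((Y)M + IⁿM)`-regular for `n > 0`, where `I = q_{k+1}⋯q_d`:
`(Y)M : y_u = (Y)M` and `[(Y)M + IⁿM] : y_u = (Y)M + IⁿM`. [cite: Cesnavicius2021, Prop. 3.10 (a)] -/
theorem kawasakiInput_a (hx : IsPStandard M xs) {k : ℕ} (hk : k < xs.length) {Y : List R} {yu : R}
    (hys : IsSecantSequence M (xs.drop k ++ (Y ++ [yu])))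
    (hym : ∀ y ∈ Y ++ [yu], y ∈ maximalIdeal R)
    (H : colonBy (ofList Y • ⊤ ⊔ tailIdeal xs k • ⊤ : Submodule R M) yu =
      ofList Y • ⊤ ⊔ tailIdeal xs k • ⊤) {n : ℕ} (hn : 0 < n) :
    colonBy (ofList Y • ⊤ : Submodule R M) yu = ofList Y • ⊤ ∧
      colonBy (ofList Y • ⊤ ⊔ prodPow xs (fun _ => n) k (xs.length - 1) • ⊤ : Submodule R M) yu =
        ofList Y • ⊤ ⊔ prodPow xs (fun _ => n) k (xs.length - 1) • ⊤ := by
  refine ⟨hx.kawasaki331 hys hym H, ?_⟩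
  have := hx.kawasaki332 hys hym H (i := k) (j := xs.length - 1) le_rfl (by omega) (by omega)
    (n := fun _ => n) (fun _ _ => hn) (L := []) (by simp)
  rwa [List.append_nil] at this

/-- **(KI-a)**, regularity form: under the hypotheses of `kawasakiInput_a` stated with
`IsSMulRegular`, if `y_u` is `M/((Y)M + q_{k+1}M)`-regular then it is `M/(Y)M`-regular and
`M/((Y)M + IⁿM)`-regular (`I = q_{k+1}⋯q_d`, `n > 0`). [cite: Cesnavicius2021, Prop. 3.10 (a)] -/
theorem kawasakiInput_a_isSMulRegular (hx : IsPStandard M xs) {k : ℕ} (hk : k < xs.length)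
    {Y : List R} {yu : R} (hys : IsSecantSequence M (xs.drop k ++ (Y ++ [yu])))
    (hym : ∀ y ∈ Y ++ [yu], y ∈ maximalIdeal R)
    (H : IsSMulRegular (M ⧸ (ofList Y • ⊤ ⊔ tailIdeal xs k • ⊤ : Submodule R M)) yu)
    {n : ℕ} (hn : 0 < n) :
    IsSMulRegular (M ⧸ (ofList Y • ⊤ : Submodule R M)) yu ∧
      IsSMulRegular (M ⧸ (ofList Y • ⊤ ⊔ prodPow xs (fun _ => n) k (xs.length - 1) • ⊤ :
        Submodule R M)) yu := by
  rw [isSMulRegular_quotient_iff_colonBy_eq] at H ⊢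
  rw [isSMulRegular_quotient_iff_colonBy_eq]
  exact hx.kawasakiInput_a hk hys hym H hn

end IsPStandard

end Literature.AlgebraicGeometry.Resolution
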